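import Literature.Probability.RandomPlanarGeometry.SLETraceOptionalMarkov
import Literature.Probability.RandomPlanarGeometry.SLETraceAdaptedVersion
import Literature.Probability.Process.OptionalHitting
import HarnessLib

/-!
# The conformal Markov property of the SLE trace at the hitting time of a closed set

Topic `Probability/RandomPlanarGeometry`; theorems only. Let `γ = sleTrace κ ω` be the chordal
SLE_κ trace (`HasSLETrace κ`), `A ⊆ ℂ` closed and `τ_A = hittingAfter (t ω ↦ γ_ω(t)) A 0` the
first hitting time of `A` BY THE TRACE. The conformal Markov property at `τ_A` — "apply the Markov
property at the first hitting time of `B(z, ε)`" (Beffara (2008), §3); Rohde–Schramm (2005), §7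
p. 911; Lawler (2005), §6.2–6.3; the domain Markov property of chordal SLE in a domain — does not
follow formally from the strong Markov property at RAW stopping times
(`SLETraceStrongMarkov.lean`): the trace is only an a.e.-defined functional of the Brownian path,
and `τ_A` is not a stopping time of the raw filtration `𝓕ᵂ`. This file closes the gap.

* `exists_isStoppingTime_rightCont_ae_eq_hitting` — **`τ_A` is a.s. an optional time**: it
  coincides almost surely with a stopping time `σ` of `𝓕ᵂ₊`, the hitting time of `A` computed
  from the ADAPTED boundary-limit version of the trace (`SLETraceAdaptedVersion.lean`,
  `Literature.Probability.Process.exists_isOptionalTime_eq_hittingAfter`).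
* `setIntegral_sleTraceAfter_hitting_eq_setIntegral_integral_of` — the **freezing formula at
  `τ_A`** for a frozen datum `X ω (τ_A ω)` given by any `X : (ℝ≥0 → ℝ) → WithTop ℝ≥0 → 𝒳` such
  that `ω ↦ X ω (σ ω)` is `𝓕ᵂ_{σ+}`-measurable for every `𝓕ᵂ₊`-stopping time `σ`:
  `E[F(X(τ_A), γ^τ); τ_A < ∞] = E[E_{ω'}[F(X(τ_A)(ω), γ(ω'))]; τ_A < ∞]` for bounded jointly
  measurable `F` — both sides depend on the random time only through its value, so `σ` may be
  replaced by `τ_A` (`setIntegral_sleTraceAfter_eq_setIntegral_integral_rightCont`).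
* `setIntegral_sleTraceAfter_hitting_eq_setIntegral_integral` — the case
  `X = past = (W(· ∧ τ_A), τ_A)`, the driving path stopped at `τ_A` (raw path space) and the time;
  `setIntegral_sleTraceAfter_hitting_eq_setIntegral_integral_continuousMap` — the same with the
  stopped path bundled in `C(ℝ≥0, ℝ)` (Borel σ-algebra; the form needed for functionals of the
  configuration such as the inverse Loewner map at the variable time `τ_A`).
* `ae_sleTrace_add_eq_extendFrom_hitting` — a.s. on `{τ_A = r < ∞}`, the chain of
  `√κ (B_{r+·} - B_r)` is generated by `γ^τ = sleTraceAfter κ τ_A ω` and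
  `γ(r + u) = F_r(γ^τ(u) + W(r))` for all `u` (`F_r` the continuous extension of `g_r⁻¹`).

Conditionally on the past up to `τ_A` and on `{τ_A < ∞}`, the trace of the increments after `τ_A`
is a fresh SLE_κ trace, attached to the tip by the conformal map `F_{τ_A}(· + W(τ_A))`.

## References

* S. Rohde, O. Schramm, *Basic properties of SLE*, Ann. of Math. 161 (2005), Prop. 2.1, §7
  p. 911.
* G. F. Lawler, *Conformally Invariant Processes in the Plane*, AMS (2005), §6.2–6.3.
* V. Beffara, *The dimension of the SLE curves*, Ann. Probab. 36 (2008), §3.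
* J.-F. Le Gall, *Brownian Motion, Martingales, and Stochastic Calculus* (2016), Thm. 2.20.
* D. Revuz, M. Yor, *Continuous Martingales and Brownian Motion* (1999), Ch. I, Prop. (4.6).
-/

noncomputable section

open Set Filter Topology MeasureTheory ProbabilityTheory Complex
open UpperHalfPlane (upperHalfPlaneSet isOpen_upperHalfPlaneSet)
open scoped NNReal

namespace Literature.Probability.RandomPlanarGeometry

open Literature.Probability.Process
open scoped PathBorel

variable {κ : ℝ≥0}

/-! ### Hitting times of closed sets by the trace are almost surely optional -/

/-- **The first hitting time of a closed set by the SLE trace is a.s. an optional time**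
(`HasSLETrace κ`): there is a stopping time `σ` of `𝓕ᵂ₊` with
`σ = τ_A = hittingAfter (t ω ↦ γ_ω(t)) A 0` almost surely — the hitting time of `A` computed from
the adapted boundary-limit version of the trace (`exists_adapted_traceVersion`,
`Literature.Probability.Process.exists_isOptionalTime_eq_hittingAfter`), which agrees with `τ_A`
on the generation event. Revuz–Yor (1999), Ch. I Prop. (4.6); Rohde–Schramm (2005), §3 p. 896.
[cite: RevuzYor1999, Ch. I Prop. (4.6)] -/
theorem exists_isStoppingTime_rightCont_ae_eq_hitting (h0 : HasSLETrace κ) {A : Set ℂ}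
    (hA : IsClosed A) :
    ∃ σ : (ℝ≥0 → ℝ) → WithTop ℝ≥0, IsStoppingTime brownianFiltration.rightCont σ ∧
      ∀ᵐ ω ∂Process.preWienerMeasure, σ ω = hittingAfter (fun t ω ↦ sleTrace κ ω t) A 0 ω := by
  obtain ⟨Y, hY, hYeq⟩ := exists_adapted_traceVersion κ
  obtain ⟨σ, hσ, hσeq⟩ := exists_isOptionalTime_eq_hittingAfter (𝓕 := brownianFiltration)
    (u := fun t ω ↦ sleTrace κ ω t) (Y := Y) hY hA
  refine ⟨σ, hσ.isStoppingTime_rightCont, ?_⟩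
  filter_upwards [h0] with ω hω
  exact hσeq ω (Loewner.isGeneratedByCurve_trace hω).continuous (hYeq ω hω)

/-! ### The freezing formula at the hitting time -/

/-- **The conformal Markov property of the SLE trace at the hitting time of a closed set, general
frozen datum.** Under `HasSLETrace κ`, let `A ⊆ ℂ` be closed, `τ = τ_A` the first hitting time of
`A` by the trace, `X : (ℝ≥0 → ℝ) → WithTop ℝ≥0 → 𝒳` a "frozen datum as a function of the sample
and of the value of the time" such that `ω ↦ X ω (σ ω)` is `𝓕ᵂ_{σ+}`-measurable for every
stopping time `σ` of `𝓕ᵂ₊` (e.g. the stopped path and the time, `measurable_stoppedPast_rightCont`,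
`measurable_stoppedPastC_rightCont`), and `F` bounded and jointly measurable. Then
`E[F(X(τ), γ^τ); τ < ∞] = E[ E_{ω'}[F(X(τ)(ω), γ(ω'))] ; τ < ∞]`. Proof: `τ` is a.s. the
`𝓕ᵂ₊`-stopping time `σ` of `exists_isStoppingTime_rightCont_ae_eq_hitting`; both sides depend on
the time only through its value (`sleTraceAfter_congr`), and at `σ` this is
`setIntegral_sleTraceAfter_eq_setIntegral_integral_rightCont`. Rohde–Schramm (2005), §7 p. 911;
Lawler (2005), §6.2–6.3; Beffara (2008), §3. [cite: RohdeSchramm2005, Prop. 2.1 and §7 p. 911] -/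
theorem setIntegral_sleTraceAfter_hitting_eq_setIntegral_integral_of {𝒳 : Type*}
    [MeasurableSpace 𝒳] (h0 : HasSLETrace κ) {A : Set ℂ} (hA : IsClosed A)
    (X : (ℝ≥0 → ℝ) → WithTop ℝ≥0 → 𝒳)
    (hX : ∀ (σ : (ℝ≥0 → ℝ) → WithTop ℝ≥0) (hσ : IsStoppingTime brownianFiltration.rightCont σ),
      Measurable[hσ.measurableSpace] fun ω ↦ X ω (σ ω))
    {F : 𝒳 → (ℝ≥0 → ℂ) → ℝ} (hFm : Measurable (Function.uncurry F)) {C : ℝ}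
    (hFb : ∀ x γ, |F x γ| ≤ C) :
    let τ : (ℝ≥0 → ℝ) → WithTop ℝ≥0 := hittingAfter (fun t ω ↦ sleTrace κ ω t) A 0
    ∫ ω in {ω | τ ω ≠ ⊤}, F (X ω (τ ω)) (sleTraceAfter κ τ ω) ∂Process.preWienerMeasure =
      ∫ ω in {ω | τ ω ≠ ⊤}, (∫ ω', F (X ω (τ ω)) (sleTrace κ ω') ∂Process.preWienerMeasure)
        ∂Process.preWienerMeasure := by
  intro τ
  obtain ⟨σ, hσ, hσeq⟩ := exists_isStoppingTime_rightCont_ae_eq_hitting h0 hA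
  have hσeq' : ∀ᵐ ω ∂Process.preWienerMeasure, τ ω = σ ω := by
    filter_upwards [hσeq] with ω hω using hω.symm
  have hmain := setIntegral_sleTraceAfter_eq_setIntegral_integral_rightCont h0 hσ (hX σ hσ) hFm
    hFb (@MeasurableSet.univ _ hσ.measurableSpace)
  rw [Set.univ_inter] at hmain
  have hset : {ω | σ ω ≠ ⊤} =ᵐ[Process.preWienerMeasure] {ω | τ ω ≠ ⊤} := by
    filter_upwards [hσeq'] with ω hω
    change (σ ω ≠ ⊤) = (τ ω ≠ ⊤)
    rw [hω]
  calc ∫ ω in {ω | τ ω ≠ ⊤}, F (X ω (τ ω)) (sleTraceAfter κ τ ω) ∂Process.preWienerMeasure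
      = ∫ ω in {ω | σ ω ≠ ⊤}, F (X ω (σ ω)) (sleTraceAfter κ σ ω) ∂Process.preWienerMeasure := by
        rw [setIntegral_congr_set hset]
        refine integral_congr_ae (ae_restrict_of_ae ?_)
        filter_upwards [hσeq'] with ω hω
        rw [hω, sleTraceAfter_congr hω]
    _ = ∫ ω in {ω | σ ω ≠ ⊤}, (∫ ω', F (X ω (σ ω)) (sleTrace κ ω') ∂Process.preWienerMeasure)
          ∂Process.preWienerMeasure := hmain
    _ = ∫ ω in {ω | τ ω ≠ ⊤}, (∫ ω', F (X ω (τ ω)) (sleTrace κ ω') ∂Process.preWienerMeasure)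
          ∂Process.preWienerMeasure := by
        rw [setIntegral_congr_set hset]
        refine integral_congr_ae (ae_restrict_of_ae ?_)
        filter_upwards [hσeq'] with ω hω
        rw [hω]

/-- **The conformal Markov property of the SLE trace at the hitting time of a closed set
(freezing formula).** Under `HasSLETrace κ` (`κ > 0`), for a closed `A ⊆ ℂ`, `τ = τ_A` the first
hitting time of `A` by the trace, `past ω = (u ↦ W(u ∧ τ), τ)` the driving path stopped at `τ`
(raw path space; read `W(· ∧ 0) = 0` on `{τ = ∞}`) together with `τ`, and `F` bounded and jointly
measurable: `E[F(past, γ^τ); τ < ∞] = E[ E_{ω'}[F(past(ω), γ(ω'))] ; τ < ∞]` — conditionally on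
the past up to `τ_A` and on `{τ_A < ∞}`, the trace `γ^τ` of the increments after `τ_A` is a fresh
SLE_κ trace (and `γ(τ + ·) = F_τ(γ^τ + W(τ))`, `ae_sleTrace_add_eq_extendFrom_hitting`).
Rohde–Schramm (2005), §7 p. 911; Lawler (2005), §6.2–6.3; Beffara (2008), §3.
[cite: RohdeSchramm2005, Prop. 2.1 and §7 p. 911] -/
theorem setIntegral_sleTraceAfter_hitting_eq_setIntegral_integral (h0 : HasSLETrace κ)
    (hκ : 0 < κ) {A : Set ℂ} (hA : IsClosed A)
    {F : ((ℝ≥0 → ℝ) × WithTop ℝ≥0) → (ℝ≥0 → ℂ) → ℝ}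
    (hFm : Measurable (Function.uncurry F)) {C : ℝ} (hFb : ∀ x γ, |F x γ| ≤ C) :
    let τ : (ℝ≥0 → ℝ) → WithTop ℝ≥0 := hittingAfter (fun t ω ↦ sleTrace κ ω t) A 0
    let past : (ℝ≥0 → ℝ) → (ℝ≥0 → ℝ) × WithTop ℝ≥0 :=
      fun ω ↦ (fun u ↦ sleDriving κ ω (min u ((τ ω).untopD 0)), τ ω)
    ∫ ω in {ω | τ ω ≠ ⊤}, F (past ω) (sleTraceAfter κ τ ω) ∂Process.preWienerMeasure =
      ∫ ω in {ω | τ ω ≠ ⊤}, (∫ ω', F (past ω) (sleTrace κ ω') ∂Process.preWienerMeasure)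
        ∂Process.preWienerMeasure := by
  have _hκ := hκ
  exact setIntegral_sleTraceAfter_hitting_eq_setIntegral_integral_of h0 hA
    (fun ω c ↦ ((fun u ↦ sleDriving κ ω (min u (c.untopD 0))), c))
    (fun σ hσ ↦ measurable_stoppedPast_rightCont κ hσ) hFm hFb

/-- **The conformal Markov property of the SLE trace at the hitting time of a closed set
(freezing formula, continuous-path past).** The same as
`setIntegral_sleTraceAfter_hitting_eq_setIntegral_integral` with the stopped driving path
bundled as an element of `C(ℝ≥0, ℝ)` (Borel σ-algebra of the compact-open topology, scoped
instance `PathBorel`): for `F : (C(ℝ≥0, ℝ) × WithTop ℝ≥0) → (ℝ≥0 → ℂ) → ℝ` bounded and jointly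
measurable, `E[F(past', γ^τ); τ < ∞] = E[ E_{ω'}[F(past'(ω), γ(ω'))] ; τ < ∞]`. Functionals of
the configuration at time `τ` (the inverse Loewner map `f_τ`, the hull `K_τ`) are Borel on
`C(ℝ≥0, ℝ) × [0, ∞]` though not measurable on the raw product path space.
Rohde–Schramm (2005), §7 p. 911; Lawler (2005), §6.2–6.3.
[cite: RohdeSchramm2005, Prop. 2.1 and §7 p. 911] -/
theorem setIntegral_sleTraceAfter_hitting_eq_setIntegral_integral_continuousMap
    (h0 : HasSLETrace κ) (hκ : 0 < κ) {A : Set ℂ} (hA : IsClosed A)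
    {F : (C(ℝ≥0, ℝ) × WithTop ℝ≥0) → (ℝ≥0 → ℂ) → ℝ}
    (hFm : Measurable (Function.uncurry F)) {C : ℝ} (hFb : ∀ x γ, |F x γ| ≤ C) :
    let τ : (ℝ≥0 → ℝ) → WithTop ℝ≥0 := hittingAfter (fun t ω ↦ sleTrace κ ω t) A 0
    let past' : (ℝ≥0 → ℝ) → C(ℝ≥0, ℝ) × WithTop ℝ≥0 :=
      fun ω ↦ (⟨fun u ↦ sleDriving κ ω (min u ((τ ω).untopD 0)),
        (continuous_sleDriving κ ω).comp (continuous_id.min continuous_const)⟩, τ ω)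
    ∫ ω in {ω | τ ω ≠ ⊤}, F (past' ω) (sleTraceAfter κ τ ω) ∂Process.preWienerMeasure =
      ∫ ω in {ω | τ ω ≠ ⊤}, (∫ ω', F (past' ω) (sleTrace κ ω') ∂Process.preWienerMeasure)
        ∂Process.preWienerMeasure := by
  have _hκ := hκ
  exact setIntegral_sleTraceAfter_hitting_eq_setIntegral_integral_of h0 hA
    (fun ω c ↦ ((⟨fun u ↦ sleDriving κ ω (min u (c.untopD 0)),
      (continuous_sleDriving κ ω).comp (continuous_id.min continuous_const)⟩ : C(ℝ≥0, ℝ)), c))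
    (fun σ hσ ↦ measurable_stoppedPastC_rightCont κ hσ) hFm hFb

/-! ### The identification `γ(τ + u) = F_τ(γ^τ(u) + W(τ))` at the hitting time -/

/-- **The Markov decomposition of the SLE trace at the hitting time of a closed set.** Under
`HasSLETrace κ` (`κ > 0`), for a closed `A ⊆ ℂ` and `τ = τ_A` the first hitting time of `A` by
the trace: almost surely, if `τ = r < ∞` then the chain of `√κ (B_{r+·} - B_r)` is generated by
the curve `γ^τ = sleTraceAfter κ τ ω`, and `γ(r + u) = F_r(γ^τ(u) + W(r))` for all `u` (`F_r`
the continuous extension of `g_r⁻¹` to the closed half-plane). Lawler (2005), §6.2;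
Rohde–Schramm (2005), §7 p. 911. [cite: RohdeSchramm2005, §7 p. 911] -/
theorem ae_sleTrace_add_eq_extendFrom_hitting (h0 : HasSLETrace κ) (hκ : 0 < κ) {A : Set ℂ}
    (hA : IsClosed A) :
    let τ : (ℝ≥0 → ℝ) → WithTop ℝ≥0 := hittingAfter (fun t ω ↦ sleTrace κ ω t) A 0
    ∀ᵐ ω ∂Process.preWienerMeasure, ∀ r : ℝ≥0, τ ω = r →
      Loewner.IsGeneratedByCurve (sleDrivingAfter κ τ ω) (sleTraceAfter κ τ ω) ∧
      ∀ u : ℝ≥0, sleTrace κ ω (r + u) =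
        extendFrom upperHalfPlaneSet (Loewner.loewnerInv (sleDriving κ ω) r)
          (sleTraceAfter κ τ ω u + sleDriving κ ω r) := by
  have _hκ := hκ
  intro τ
  obtain ⟨σ, hσ, hσeq⟩ := exists_isStoppingTime_rightCont_ae_eq_hitting h0 hA
  have hσeq' : ∀ᵐ ω ∂Process.preWienerMeasure, τ ω = σ ω := by
    filter_upwards [hσeq] with ω hω using hω.symm
  filter_upwards [hσeq', ae_sleTrace_add_eq_extendFrom_rightCont h0 hσ,
    ae_exists_isGeneratedByCurve_incrAfter_rightCont h0 hσ] with ω hω h1 h2 r hr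
  rw [sleDrivingAfter_congr hω, sleTraceAfter_congr hω]
  have hσr : σ ω = r := hω.symm.trans hr
  exact ⟨Loewner.isGeneratedByCurve_trace (h2 (by rw [hσr]; exact WithTop.coe_ne_top)), h1 r hσr⟩

end Literature.Probability.RandomPlanarGeometry
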